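import Summits.BirchSwinnertonDyer.Rank1Residual.X2.HidaLimitCongruenceAlgebra
import Literature.NumberTheory.EllipticCurves.UnrIntegersUnits
import HarnessLib

/-!
# Residual rigidity in `R₀⟦T⟧`: a congruence `C·U·X ≡ U′·Y (mod 3)` with `U, U′` units and `μ(Y) = 0` forces `C ∈ R₀ˣ`
# and `u·X ≡ Y (mod 3)` for a unit `u`

Support algebra for the crux `SigmaCongruenceAtThree` (stmt-BirchSwinnertonDyer-27120), crux idea `rankin-selberg-linearity-transplant`
(`Cruxes/SigmaCongruenceAtThree/Ideas/rankin-selberg-linearity-transplant.md`, First lemma `TwinForcesWallConstant`): in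
`R₀⟦T⟧` (`R₀ = unrIntegers 3`, a DVR with uniformiser `3`, residue field `k`), if `U, U′` are units, `Y` has a coefficient of norm
`1`, and every coefficient of `C·U·X − U′·Y` has norm `< 1`, then `‖C‖ = 1` and `u·X − Y` has all coefficients of norm `< 1` for the
unit `u = C·U·U′⁻¹`. Proof: reduce modulo the maximal ideal — "all coefficients of norm `< 1`" is "image `0` in `k⟦T⟧`"
(`map_residue_eq_zero_iff`); `k⟦T⟧` is a domain, `Ȳ ≠ 0`, `Ū′` is a unit, so `C̄·Ū·X̄ = Ū′·Ȳ ≠ 0` forces `C̄ ≠ 0`, i.e. `C` is a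
unit; and `u·X − Y = U′⁻¹·(C·U·X − U′·Y)` reduces to `0`. THEOREMS ONLY; no `sorry`; route-independent imports. The card applies it
with `X = LΠ`, `Y = L′Π′` (Σ-depleted frames). References: folklore (Washington GTM 83 §7.1: units of `A⟦T⟧`).
-/

noncomputable section

open scoped Classical

set_option linter.dupNamespace false
set_option autoImplicit false

namespace Summit.BirchSwinnertonDyer.BirchSwinnertonDyer.Theorems.UniversalToricDescentTwinForcesWallConstant

open Literature.NumberTheory.EllipticCurves Summit.BirchSwinnertonDyer.Rank1Residual.X11b
  Summit.BirchSwinnertonDyer.Rank1Residual.X2.HidaLimitAlgebra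

variable {p : ℕ} [Fact p.Prime]

/-- In `R₀` (a DVR): norm `< 1` iff not a unit iff in the maximal ideal. [folklore] -/
theorem norm_lt_one_iff_mem_maximalIdeal (c : unrIntegers p) :
    letI := isDiscreteValuationRing_unrIntegers (p := p)
    ‖(c : ℂ_[p])‖ < 1 ↔ c ∈ IsLocalRing.maximalIdeal (unrIntegers p) := by
  letI := isDiscreteValuationRing_unrIntegers (p := p)
  rw [IsLocalRing.mem_maximalIdeal, mem_nonunits_iff, unrIntegers.isUnit_iff_norm_eq_one]
  constructor
  · exact fun h ↦ ne_of_lt h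
  · exact fun h ↦ lt_of_le_of_ne (Halves.norm_coe_unrIntegers_le_one p c) h

/-- **Reduction criterion.** All coefficients of `F ∈ R₀⟦T⟧` have norm `< 1` iff `F` maps to `0` in `k⟦T⟧`, `k` the residue field
of `R₀`. [folklore] -/
theorem forall_norm_coeff_lt_one_iff_map_residue_eq_zero (F : UnrSeries p) :
    letI := isDiscreteValuationRing_unrIntegers (p := p)
    (∀ i : ℕ, ‖((PowerSeries.coeff i F : unrIntegers p) : ℂ_[p])‖ < 1) ↔
      PowerSeries.map (IsLocalRing.residue (unrIntegers p)) F = 0 := by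
  letI := isDiscreteValuationRing_unrIntegers (p := p)
  rw [PowerSeries.ext_iff]
  refine forall_congr' fun i ↦ ?_
  rw [PowerSeries.coeff_map, map_zero, IsLocalRing.residue_eq_zero_iff, norm_lt_one_iff_mem_maximalIdeal]

/-- A coefficient of norm `1` survives reduction: `F̄ ≠ 0` in `k⟦T⟧`. [folklore] -/
theorem map_residue_ne_zero_of_norm_coeff_eq_one {F : UnrSeries p}
    (hF : ∃ i : ℕ, ‖((PowerSeries.coeff i F : unrIntegers p) : ℂ_[p])‖ = 1) :
    letI := isDiscreteValuationRing_unrIntegers (p := p)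
    PowerSeries.map (IsLocalRing.residue (unrIntegers p)) F ≠ 0 := by
  letI := isDiscreteValuationRing_unrIntegers (p := p)
  intro h0
  obtain ⟨i, hi⟩ := hF
  have h := (forall_norm_coeff_lt_one_iff_map_residue_eq_zero F).mpr h0 i
  exact absurd hi (ne_of_lt h)

/-- **`TwinForcesWallConstant`, VERBATIM shape** (crux idea `rankin-selberg-linearity-transplant` on stmt-BirchSwinnertonDyer-27120):
`C·U·X ≡ U′·Y (mod 3)` in `R₀⟦T⟧` with `U, U′` units and `μ(Y) = 0` forces `‖C‖ = 1` and `u·X ≡ Y (mod 3)` for a unit `u`. [folklore] -/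
theorem twinForcesWallConstant :
    ∀ (X Y U U' : UnrSeries 3) (C : unrIntegers 3), IsUnit U → IsUnit U' →
      (∃ i : ℕ, ‖((PowerSeries.coeff i Y : unrIntegers 3) : ℂ_[3])‖ = 1) →
      (∀ i : ℕ, ‖((PowerSeries.coeff i (PowerSeries.C C * U * X - U' * Y) : unrIntegers 3) :
        ℂ_[3])‖ < 1) →
      ‖((C : unrIntegers 3) : ℂ_[3])‖ = 1 ∧
        ∃ u : UnrSeries 3, IsUnit u ∧
          ∀ i : ℕ, ‖((PowerSeries.coeff i (u * X - Y) : unrIntegers 3) : ℂ_[3])‖ < 1 := by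
  intro X Y U U' C hU hU' hY hcong
  letI := isDiscreteValuationRing_unrIntegers (p := 3)
  set red := PowerSeries.map (IsLocalRing.residue (unrIntegers 3)) with hred
  have h0 : red (PowerSeries.C C * U * X - U' * Y) = 0 :=
    (forall_norm_coeff_lt_one_iff_map_residue_eq_zero _).mp hcong
  have hYne : red Y ≠ 0 := map_residue_ne_zero_of_norm_coeff_eq_one hY
  -- `C` is a unit: otherwise `C̄ = 0` and `Ū′·Ȳ = 0` in the domain `k⟦T⟧`
  have hC : IsUnit C := by
    by_contra hC
    have hC0 : IsLocalRing.residue (unrIntegers 3) C = 0 :=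
      (IsLocalRing.residue_eq_zero_iff C).mpr ((IsLocalRing.mem_maximalIdeal C).mpr hC)
    have h1 : red (U' * Y) = 0 := by
      have := h0
      rw [map_sub, map_mul, map_mul, PowerSeries.map_C, hC0, map_zero, zero_mul, zero_mul, zero_sub,
        neg_eq_zero] at this
      exact this
    rw [map_mul] at h1
    rcases mul_eq_zero.mp h1 with hU'0 | hY0
    · exact (hU'.map red).ne_zero hU'0
    · exact hYne hY0
  refine ⟨(unrIntegers.isUnit_iff_norm_eq_one C).mp hC, ?_⟩
  -- `u = C·U·U′⁻¹`
  obtain ⟨U'u, hU'u⟩ := hU'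
  refine ⟨PowerSeries.C C * U * ↑U'u⁻¹, ?_, ?_⟩
  · exact ((hC.map PowerSeries.C).mul hU).mul (Units.isUnit _)
  · refine (forall_norm_coeff_lt_one_iff_map_residue_eq_zero _).mpr ?_
    have hfac : PowerSeries.C C * U * ↑U'u⁻¹ * X - Y = ↑U'u⁻¹ * (PowerSeries.C C * U * X - U' * Y) := by
      have hinv : (↑U'u⁻¹ : UnrSeries 3) * U' = 1 := by rw [← hU'u, Units.inv_mul]
      calc PowerSeries.C C * U * ↑U'u⁻¹ * X - Y
          = PowerSeries.C C * U * ↑U'u⁻¹ * X - ((↑U'u⁻¹ : UnrSeries 3) * U') * Y := by rw [hinv, one_mul]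
        _ = ↑U'u⁻¹ * (PowerSeries.C C * U * X - U' * Y) := by ring
    change red (PowerSeries.C C * U * ↑U'u⁻¹ * X - Y) = 0
    rw [hfac, map_mul, h0, mul_zero]

end Summit.BirchSwinnertonDyer.BirchSwinnertonDyer.Theorems.UniversalToricDescentTwinForcesWallConstant

end
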